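import Summits.QuantumFields.YangMills.Theorems.ThermodynamicCeilingsAbelWindowTransferW
import Summits.QuantumFields.YangMills.Theorems.ThermodynamicCeilingsWindowedOfSpectralR

/-!
# Route `ThermodynamicCeilings` — ANCHORED Abel transfer (pure real analysis; support for the g6 line «anchored majorant»)

D-0145 ideator seat ym-idea-11 (g5, lens «wuc»).  The windowed split of K_M (`WindowedSpectralMeasure` + `AbelWindowTransferW`)
asks degree-8 DOUBLING of the spectral weight at every base point of the window `[E₀, 1]`.  The Abel transfer at a pair of times
`t ≤ t₂` in fact needs much less: the ONE-ANCHOR MAJORANT `ν([0,E)) ≤ A (E/x₀)⁸ ν([0,x₀))` for `x₀ ≤ E ≤ 1` at the single anchor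
`x₀ ∈ [1/t₂, 4/t₂]`, plus the Laplace-weighted UV clause `∫_{E≥1} e^{-2E}dν ≤ A ν([0,1))`.  We prove
`t⁸ F(t) ≤ A' t₂⁸ F(t₂)`, `F(τ) = κ₀ + ∫ (e^{-Eτ} + e^{-E(T-τ)}) dν`, for `2 ≤ t ≤ t₂`, `2t₂ ≤ T`, with
`A' = e⁴(1 + 2A·16⁸) + A²·8⁸·e⁶ + 1`: layer cake `∫ e^{-Et} dν|_{E<1} = ∫₀¹ ν₁([0,-log s/t)) ds`, the majorant and
`(-log s)⁸ ≤ 16⁸ s^{-1/2}`, `∫₀¹ s^{-1/2} ds = 2` (landed lemmas of the edge file), the lower bound `∫ e^{-Et₂}dν ≥ e⁻⁴ν([0,x₀))`,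
the UV tail as in `AbelWindowTransferW`, reflected terms termwise.  Since the consumer of K_M uses only the anchor time `t₂ = 2R₂+2`,
this is the support half of a further weakening of crux 27776 (one anchor per measure instead of all base points) — to be filed as a
LINE by the next generation.  Mathlib + landed lemmas only; closes nothing; no summit / leaf / NT / UV / IR statement is proved.
-/

namespace Summit.QuantumFields.YangMills.Cruxes.ScaleMonotonicity.SpectralA

open MeasureTheory Set
open Summit.QuantumFields.YangMills.Cruxes.ScaleMonotonicity.Spectral (exp_integrable laplace_layer_cake cum_zero)
open Summit.QuantumFields.YangMills.Cruxes.ScaleMonotonicity.SpectralW (restrict_Iic_zero pow_eight_exp_le)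
open Summit.QuantumFields.YangMills.Cruxes.ScaleMonotonicity.SpectralEdge (pow_eight_le_exp lintegral_exp_neg_log_half)

/-- lower bound: the mass below `x₀` controls the Laplace transform at `t₂` from below when `x₀t₂ ≤ 4`. -/
theorem laplace_lower (μ : Measure ℝ) [IsFiniteMeasure μ] (hsupp : μ (Iic 0) = 0) (x₀ t₂ : ℝ) (ht₂ : 0 ≤ t₂)
    (h4 : x₀ * t₂ ≤ 4) :
    Real.exp (-4) * (μ (Iio x₀)).toReal ≤ ∫ E, Real.exp (-(E * t₂)) ∂μ := by
  have hI := exp_integrable μ hsupp t₂ ht₂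
  have h1 : ∫ E in Iio x₀, Real.exp (-4) ∂μ ≤ ∫ E in Iio x₀, Real.exp (-(E * t₂)) ∂μ := by
    refine setIntegral_mono_on (integrable_const _).integrableOn hI.integrableOn measurableSet_Iio ?_
    intro E hE
    apply Real.exp_le_exp.mpr
    have : E * t₂ ≤ x₀ * t₂ := mul_le_mul_of_nonneg_right (le_of_lt hE) ht₂
    linarith
  have h2 : ∫ E in Iio x₀, Real.exp (-(E * t₂)) ∂μ ≤ ∫ E, Real.exp (-(E * t₂)) ∂μ :=
    setIntegral_le_integral hI (Filter.Eventually.of_forall fun E => (Real.exp_pos _).le)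
  have h3 : ∫ E in Iio x₀, Real.exp (-4) ∂μ = Real.exp (-4) * (μ (Iio x₀)).toReal := by
    rw [setIntegral_const, smul_eq_mul, mul_comm]; rfl
  linarith [h3.symm.le]

/-- `(−log s)`-power bound: `y⁸ ≤ 16⁸ e^{y/2}` for `y ≥ 0`. -/
theorem pow_eight_le_exp_half (y : ℝ) (hy : 0 ≤ y) : y ^ 8 ≤ 16 ^ 8 * Real.exp (y / 2) := by
  have h := pow_eight_le_exp (y / 2) (by linarith)
  have e : y ^ 8 = 2 ^ 8 * (y / 2) ^ 8 := by ring
  rw [e]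
  have : (2:ℝ) ^ 8 * (y / 2) ^ 8 ≤ 2 ^ 8 * (8 ^ 8 * Real.exp (y / 2)) := mul_le_mul_of_nonneg_left h (by positivity)
  calc (2:ℝ) ^ 8 * (y / 2) ^ 8 ≤ 2 ^ 8 * (8 ^ 8 * Real.exp (y / 2)) := this
    _ = 16 ^ 8 * Real.exp (y / 2) := by ring

/-- **ANCHORED CORE** (window part): the one-anchor degree-8 majorant above `x₀` (unbounded range) gives
`t⁸ ∫ e^{-Et} dμ ≤ e⁴(1 + 2A·16⁸) t₂⁸ ∫ e^{-Et₂} dμ` for `0 < t ≤ t₂`, `1 ≤ x₀t₂ ≤ 4`. -/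
theorem anchored_core (μ : Measure ℝ) [IsFiniteMeasure μ] (hsupp : μ (Iic 0) = 0) (A x₀ : ℝ) (hA : 1 ≤ A)
    (hx₀ : 0 < x₀)
    (hmaj : ∀ E : ℝ, x₀ ≤ E → (μ (Iio E)).toReal ≤ A * (E / x₀) ^ 8 * (μ (Iio x₀)).toReal)
    {t t₂ : ℝ} (ht : 0 < t) (htt : t ≤ t₂) (h1 : 1 ≤ x₀ * t₂) (h4 : x₀ * t₂ ≤ 4) :
    t ^ 8 * ∫ E, Real.exp (-(E * t)) ∂μ ≤
      Real.exp 4 * (1 + 2 * A * 16 ^ 8) * t₂ ^ 8 * ∫ E, Real.exp (-(E * t₂)) ∂μ := by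
  have hA0 : 0 ≤ A := by linarith
  have ht₂0 : 0 ≤ t₂ := le_trans ht.le htt
  set m : ENNReal := μ (Iio x₀) with hm
  have hmtop : m ≠ ⊤ := measure_ne_top μ _
  -- layer cake
  have hconv : ∫ E, Real.exp (-(E * t)) ∂μ = (∫⁻ E, ENNReal.ofReal (Real.exp (-(E * t))) ∂μ).toReal :=
    integral_eq_lintegral_of_nonneg_ae (Filter.Eventually.of_forall fun E => (Real.exp_pos _).le)
      (by fun_prop : Continuous fun E : ℝ => Real.exp (-(E * t))).aestronglyMeasurable
  rw [laplace_layer_cake μ t ht] at hconv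
  -- the majorant in `ℝ≥0∞` form
  have hmajE : ∀ E : ℝ, x₀ ≤ E → μ (Iio E) ≤ ENNReal.ofReal (A * (E / x₀) ^ 8) * m := by
    intro E hE
    have h := hmaj E hE
    calc μ (Iio E) = ENNReal.ofReal ((μ (Iio E)).toReal) := (ENNReal.ofReal_toReal (measure_ne_top μ _)).symm
      _ ≤ ENNReal.ofReal (A * (E / x₀) ^ 8 * m.toReal) := ENNReal.ofReal_le_ofReal h
      _ = ENNReal.ofReal (A * (E / x₀) ^ 8) * ENNReal.ofReal m.toReal := by
          rw [ENNReal.ofReal_mul (by positivity)]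
      _ = ENNReal.ofReal (A * (E / x₀) ^ 8) * m := by rw [ENNReal.ofReal_toReal hmtop]
  set K : ℝ := A * 16 ^ 8 / (t * x₀) ^ 8 with hK
  have htx : 0 < t * x₀ := mul_pos ht hx₀
  have hK0 : 0 ≤ K := by positivity
  -- pointwise bound of the layer-cake integrand
  have hpt : ∀ s ∈ Ioi (0:ℝ), μ (Iio (-Real.log s / t)) ≤
      (Ioo (0:ℝ) 1).indicator (fun s => m * ENNReal.ofReal (1 + K * Real.exp (-Real.log s / 2))) s := by
    intro s hs
    have hs0 : (0:ℝ) < s := hs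
    by_cases h1s : s < 1
    · rw [indicator_of_mem (show s ∈ Ioo (0:ℝ) 1 from ⟨hs0, h1s⟩)]
      have hlog : Real.log s ≤ 0 := Real.log_nonpos hs0.le h1s.le
      set y := -Real.log s with hy
      have hy0 : 0 ≤ y := by rw [hy]; linarith
      have hone : (1 : ENNReal) ≤ ENNReal.ofReal (1 + K * Real.exp (y / 2)) := by
        rw [← ENNReal.ofReal_one]
        exact ENNReal.ofReal_le_ofReal (by nlinarith [Real.exp_pos (y / 2)])
      by_cases hEx : x₀ ≤ y / t
      · have h := hmajE (y / t) hEx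
        have hy8 := pow_eight_le_exp_half y hy0
        have hfrac : A * (y / t / x₀) ^ 8 ≤ K * Real.exp (y / 2) := by
          have e1 : (y / t / x₀) ^ 8 = y ^ 8 / (t * x₀) ^ 8 := by rw [div_div, div_pow]
          rw [e1, hK]
          rw [show A * (y ^ 8 / (t * x₀) ^ 8) = A / (t * x₀) ^ 8 * y ^ 8 by ring,
            show A * 16 ^ 8 / (t * x₀) ^ 8 * Real.exp (y / 2) = A / (t * x₀) ^ 8 * (16 ^ 8 * Real.exp (y / 2)) by ring]
          exact mul_le_mul_of_nonneg_left hy8 (by positivity)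
        calc μ (Iio (y / t)) ≤ ENNReal.ofReal (A * (y / t / x₀) ^ 8) * m := h
          _ ≤ ENNReal.ofReal (K * Real.exp (y / 2)) * m := by gcongr
          _ ≤ ENNReal.ofReal (1 + K * Real.exp (y / 2)) * m := by
              gcongr; linarith
          _ = m * ENNReal.ofReal (1 + K * Real.exp (y / 2)) := mul_comm _ _
      · push Not at hEx
        calc μ (Iio (y / t)) ≤ m := measure_mono (Iio_subset_Iio hEx.le)
          _ = m * 1 := (mul_one m).symm
          _ ≤ m * ENNReal.ofReal (1 + K * Real.exp (y / 2)) := by gcongr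
    · push Not at h1s
      rw [indicator_of_notMem (fun h : s ∈ Ioo (0:ℝ) 1 => (not_lt.2 h1s) h.2)]
      have hlog : 0 ≤ Real.log s := Real.log_nonneg h1s
      have : -Real.log s / t ≤ 0 := div_nonpos_of_nonpos_of_nonneg (by linarith) ht.le
      rw [cum_zero μ hsupp _ this]
  -- integrate the pointwise bound
  have hint : ∫⁻ s in Ioi (0:ℝ), μ (Iio (-Real.log s / t)) ≤
      m * (ENNReal.ofReal 1 + ENNReal.ofReal K * ENNReal.ofReal 2) := by
    calc ∫⁻ s in Ioi (0:ℝ), μ (Iio (-Real.log s / t))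
        ≤ ∫⁻ s in Ioi (0:ℝ), (Ioo (0:ℝ) 1).indicator (fun s => m * ENNReal.ofReal (1 + K * Real.exp (-Real.log s / 2))) s :=
          setLIntegral_mono' measurableSet_Ioi hpt
      _ = ∫⁻ s in Ioo (0:ℝ) 1, m * ENNReal.ofReal (1 + K * Real.exp (-Real.log s / 2)) := by
          rw [lintegral_indicator measurableSet_Ioo, Measure.restrict_restrict measurableSet_Ioo,
            show Ioo (0:ℝ) 1 ∩ Ioi 0 = Ioo 0 1 from inter_eq_left.mpr Ioo_subset_Ioi_self]
      _ = m * ∫⁻ s in Ioo (0:ℝ) 1, ENNReal.ofReal (1 + K * Real.exp (-Real.log s / 2)) :=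
          lintegral_const_mul' m _ hmtop
      _ = m * ∫⁻ s in Ioo (0:ℝ) 1, (ENNReal.ofReal 1 + ENNReal.ofReal K * ENNReal.ofReal (Real.exp (-Real.log s / 2))) := by
          congr 1
          refine setLIntegral_congr_fun measurableSet_Ioo (fun s _ => ?_)
          rw [ENNReal.ofReal_add zero_le_one (by positivity), ENNReal.ofReal_mul hK0]
      _ = m * (ENNReal.ofReal 1 * volume (Ioo (0:ℝ) 1) +
            ENNReal.ofReal K * ∫⁻ s in Ioo (0:ℝ) 1, ENNReal.ofReal (Real.exp (-Real.log s / 2))) := by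
          rw [lintegral_add_left measurable_const, setLIntegral_const,
            lintegral_const_mul' _ _ ENNReal.ofReal_ne_top]
      _ = m * (ENNReal.ofReal 1 + ENNReal.ofReal K * ENNReal.ofReal 2) := by
          rw [Real.volume_Ioo, lintegral_exp_neg_log_half, sub_zero, ENNReal.ofReal_one, mul_one]
  -- back to reals
  have hne2 : ENNReal.ofReal 1 + ENNReal.ofReal K * ENNReal.ofReal 2 ≠ ⊤ :=
    ENNReal.add_ne_top.2 ⟨ENNReal.ofReal_ne_top, ENNReal.mul_ne_top ENNReal.ofReal_ne_top ENNReal.ofReal_ne_top⟩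
  have hup : ∫ E, Real.exp (-(E * t)) ∂μ ≤ m.toReal * (1 + 2 * K) := by
    rw [hconv]
    calc (∫⁻ s in Ioi (0:ℝ), μ (Iio (-Real.log s / t))).toReal
        ≤ (m * (ENNReal.ofReal 1 + ENNReal.ofReal K * ENNReal.ofReal 2)).toReal :=
          ENNReal.toReal_mono (ENNReal.mul_ne_top hmtop hne2) hint
      _ = m.toReal * (1 + 2 * K) := by
          rw [ENNReal.toReal_mul, ENNReal.toReal_add ENNReal.ofReal_ne_top
              (ENNReal.mul_ne_top ENNReal.ofReal_ne_top ENNReal.ofReal_ne_top),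
            ENNReal.toReal_mul, ENNReal.toReal_ofReal zero_le_one, ENNReal.toReal_ofReal hK0,
            ENNReal.toReal_ofReal zero_le_two]
          ring
  -- the anchor: `K ≤ A 16⁸ (t₂/t)⁸` since `x₀ t₂ ≥ 1`
  have hKle : t ^ 8 * K ≤ A * 16 ^ 8 * t₂ ^ 8 := by
    have hpos : 0 < (t * x₀) ^ 8 := by positivity
    have e1 : t ^ 8 * K = A * 16 ^ 8 * (t ^ 8 / (t * x₀) ^ 8) := by rw [hK]; ring
    have e2 : t ^ 8 / (t * x₀) ^ 8 = 1 / x₀ ^ 8 := by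
      rw [mul_pow]; field_simp
    rw [e1, e2]
    have h3 : 1 / x₀ ^ 8 ≤ t₂ ^ 8 := by
      rw [div_le_iff₀ (by positivity)]
      have : (1:ℝ) ≤ (t₂ * x₀) ^ 8 := one_le_pow₀ (by linarith [mul_comm x₀ t₂])
      calc (1:ℝ) ≤ (t₂ * x₀) ^ 8 := this
        _ = t₂ ^ 8 * x₀ ^ 8 := mul_pow _ _ _
    exact mul_le_mul_of_nonneg_left h3 (by positivity)
  have hlow := laplace_lower μ hsupp x₀ t₂ ht₂0 h4
  have he : Real.exp 4 * Real.exp (-4) = 1 := by rw [← Real.exp_add]; norm_num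
  have hm0 : 0 ≤ m.toReal := ENNReal.toReal_nonneg
  have ht8 : t ^ 8 ≤ t₂ ^ 8 := pow_le_pow_left₀ ht.le htt 8
  have e1 : t ^ 8 * (m.toReal * (1 + 2 * K)) ≤ m.toReal * t₂ ^ 8 * (1 + 2 * A * 16 ^ 8) := by
    have ha := mul_le_mul_of_nonneg_left ht8 hm0
    have hb := mul_le_mul_of_nonneg_left hKle hm0
    have lhs_eq : t ^ 8 * (m.toReal * (1 + 2 * K)) = m.toReal * t ^ 8 + 2 * (m.toReal * (t ^ 8 * K)) := by ring
    have rhs_eq : m.toReal * t₂ ^ 8 * (1 + 2 * A * 16 ^ 8) =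
        m.toReal * t₂ ^ 8 + 2 * (m.toReal * (A * 16 ^ 8 * t₂ ^ 8)) := by ring
    rw [lhs_eq, rhs_eq]
    linarith
  have e2 : m.toReal ≤ Real.exp 4 * ∫ E, Real.exp (-(E * t₂)) ∂μ := by
    have := mul_le_mul_of_nonneg_left hlow (Real.exp_pos 4).le
    rw [← mul_assoc, he, one_mul] at this
    exact this
  have hF0 : 0 ≤ ∫ E, Real.exp (-(E * t₂)) ∂μ := integral_nonneg fun E => (Real.exp_pos _).le
  have hC0 : 0 ≤ t₂ ^ 8 * (1 + 2 * A * 16 ^ 8) := by positivity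
  calc t ^ 8 * ∫ E, Real.exp (-(E * t)) ∂μ ≤ t ^ 8 * (m.toReal * (1 + 2 * K)) :=
        mul_le_mul_of_nonneg_left hup (by positivity)
    _ ≤ m.toReal * t₂ ^ 8 * (1 + 2 * A * 16 ^ 8) := e1
    _ = m.toReal * (t₂ ^ 8 * (1 + 2 * A * 16 ^ 8)) := by ring
    _ ≤ (Real.exp 4 * ∫ E, Real.exp (-(E * t₂)) ∂μ) * (t₂ ^ 8 * (1 + 2 * A * 16 ^ 8)) :=
        mul_le_mul_of_nonneg_right e2 hC0
    _ = Real.exp 4 * (1 + 2 * A * 16 ^ 8) * t₂ ^ 8 * ∫ E, Real.exp (-(E * t₂)) ∂μ := by ring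

/-- the windowed majorant (on `[x₀,1]`, `x₀ ≤ 1`) gives the unbounded-range majorant for the restriction to `[0,1)`. -/
theorem majorant_restrict (ν : Measure ℝ) [IsFiniteMeasure ν] (A x₀ : ℝ) (hA : 1 ≤ A) (hx₀ : 0 < x₀) (hx₀1 : x₀ ≤ 1)
    (hmaj : ∀ E : ℝ, x₀ ≤ E → E ≤ 1 → (ν (Iio E)).toReal ≤ A * (E / x₀) ^ 8 * (ν (Iio x₀)).toReal) :
    ∀ E : ℝ, x₀ ≤ E →
      ((ν.restrict (Iio 1)) (Iio E)).toReal ≤ A * (E / x₀) ^ 8 * ((ν.restrict (Iio 1)) (Iio x₀)).toReal := by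
  intro E hE
  have hres : ∀ y : ℝ, (ν.restrict (Iio 1)) (Iio y) = ν (Iio (min y 1)) := fun y => by
    rw [Measure.restrict_apply measurableSet_Iio, Iio_inter_Iio]
  rw [hres, hres, min_eq_left hx₀1]
  by_cases hE1 : E ≤ 1
  · rw [min_eq_left hE1]; exact hmaj E hE hE1
  · push Not at hE1
    rw [min_eq_right hE1.le]
    have h1 := hmaj 1 (by linarith) le_rfl
    have hA0 : 0 ≤ A := by linarith
    have hp : (1 / x₀) ^ 8 ≤ (E / x₀) ^ 8 :=
      pow_le_pow_left₀ (by positivity) (div_le_div_of_nonneg_right hE1.le hx₀.le) 8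
    have hm : 0 ≤ (ν (Iio x₀)).toReal := ENNReal.toReal_nonneg
    calc (ν (Iio 1)).toReal ≤ A * (1 / x₀) ^ 8 * (ν (Iio x₀)).toReal := h1
      _ ≤ A * (E / x₀) ^ 8 * (ν (Iio x₀)).toReal :=
          mul_le_mul_of_nonneg_right (mul_le_mul_of_nonneg_left hp hA0) hm

/-- the UV anchor, majorant version: `ν([0,1)) ≤ A e⁴ t₂⁸ ∫ e^{-Et₂} dν` from the majorant at `E = 1` and `1 ≤ x₀t₂ ≤ 4`. -/
theorem cum_one_le_anchored (ν : Measure ℝ) [IsFiniteMeasure ν] (hsupp : ν (Iic 0) = 0) (A x₀ : ℝ) (hA : 1 ≤ A)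
    (hx₀ : 0 < x₀) (hx₀1 : x₀ ≤ 1)
    (hmaj : ∀ E : ℝ, x₀ ≤ E → E ≤ 1 → (ν (Iio E)).toReal ≤ A * (E / x₀) ^ 8 * (ν (Iio x₀)).toReal)
    {t₂ : ℝ} (ht₂ : 0 ≤ t₂) (h1 : 1 ≤ x₀ * t₂) (h4 : x₀ * t₂ ≤ 4) :
    (ν (Iio 1)).toReal ≤ A * Real.exp 4 * t₂ ^ 8 * ∫ E, Real.exp (-(E * t₂)) ∂ν := by
  have hA0 : 0 ≤ A := by linarith
  have hm : 0 ≤ (ν (Iio x₀)).toReal := ENNReal.toReal_nonneg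
  have hmaj1 := hmaj 1 (by linarith) le_rfl
  have hx8 : (1 / x₀) ^ 8 ≤ t₂ ^ 8 := by
    refine pow_le_pow_left₀ (by positivity) ?_ 8
    rw [div_le_iff₀ hx₀]; linarith [mul_comm x₀ t₂]
  have hlow := laplace_lower ν hsupp x₀ t₂ ht₂ h4
  have he : Real.exp 4 * Real.exp (-4) = 1 := by rw [← Real.exp_add]; norm_num
  have e2 : (ν (Iio x₀)).toReal ≤ Real.exp 4 * ∫ E, Real.exp (-(E * t₂)) ∂ν := by
    have := mul_le_mul_of_nonneg_left hlow (Real.exp_pos 4).le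
    rw [← mul_assoc, he, one_mul] at this
    exact this
  have hF0 : 0 ≤ ∫ E, Real.exp (-(E * t₂)) ∂ν := integral_nonneg fun E => (Real.exp_pos _).le
  calc (ν (Iio 1)).toReal ≤ A * (1 / x₀) ^ 8 * (ν (Iio x₀)).toReal := hmaj1
    _ ≤ A * t₂ ^ 8 * (ν (Iio x₀)).toReal := mul_le_mul_of_nonneg_right (mul_le_mul_of_nonneg_left hx8 hA0) hm
    _ ≤ A * t₂ ^ 8 * (Real.exp 4 * ∫ E, Real.exp (-(E * t₂)) ∂ν) := mul_le_mul_of_nonneg_left e2 (by positivity)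
    _ = A * Real.exp 4 * t₂ ^ 8 * ∫ E, Real.exp (-(E * t₂)) ∂ν := by ring

/-- **ANCHORED ABEL TRANSFER (core form).**  One-anchor majorant on `[x₀,1]` (`1 ≤ x₀t₂ ≤ 4`, `x₀ ≤ 1`) + Laplace-weighted UV
clause ⇒ `t⁸ F(t) ≤ A' t₂⁸ F(t₂)` for `2 ≤ t ≤ t₂`, `2t₂ ≤ T`, with `A' = e⁴(1 + 2A·16⁸) + A²·8⁸·e⁶ + 1`. -/
theorem abelAnchoredTransfer_core (ν : Measure ℝ) (κ₀ A x₀ T : ℝ) (hfin : IsFiniteMeasure ν)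
    (hsupp : ν (Iic 0) = 0) (hκ₀ : 0 ≤ κ₀) (hA : 1 ≤ A) (hx₀ : 0 < x₀) (hx₀1 : x₀ ≤ 1)
    (hmaj : ∀ E : ℝ, x₀ ≤ E → E ≤ 1 → (ν (Iio E)).toReal ≤ A * (E / x₀) ^ 8 * (ν (Iio x₀)).toReal)
    (huv : (∫ E in Ici (1 : ℝ), Real.exp (-(2 * E)) ∂ν) ≤ A * (ν (Iio 1)).toReal)
    (t t₂ : ℝ) (ht : 2 ≤ t) (htt : t ≤ t₂) (hT : 2 * t₂ ≤ T) (h1 : 1 ≤ x₀ * t₂) (h4 : x₀ * t₂ ≤ 4) :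
    t ^ 8 * (κ₀ + ∫ E, (Real.exp (-(E * t)) + Real.exp (-(E * (T - t)))) ∂ν) ≤
      (Real.exp 4 * (1 + 2 * A * 16 ^ 8) + A ^ 2 * 8 ^ 8 * Real.exp 6 + 1) * t₂ ^ 8 *
        (κ₀ + ∫ E, (Real.exp (-(E * t₂)) + Real.exp (-(E * (T - t₂)))) ∂ν) := by
  haveI := hfin
  have ht0 : 0 < t := by linarith
  have ht₂ : 2 ≤ t₂ := le_trans ht htt
  have ht₂0 : 0 < t₂ := by linarith
  set ν₁ : Measure ℝ := ν.restrict (Iio 1) with hν₁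
  set ν₂ : Measure ℝ := ν.restrict (Ici 1) with hν₂
  have hsupp₁ : ν₁ (Iic 0) = 0 := restrict_Iic_zero ν hsupp _
  have hsupp₂ : ν₂ (Iic 0) = 0 := restrict_Iic_zero ν hsupp _
  have hsplit : ν₁ + ν₂ = ν := by
    rw [hν₁, hν₂, ← compl_Iio, Measure.restrict_add_restrict_compl measurableSet_Iio]
  set f : ℝ → ℝ → ℝ := fun τ E => Real.exp (-(E * τ)) with hf
  have hfI : ∀ (μ : Measure ℝ) [IsFiniteMeasure μ], μ (Iic 0) = 0 → ∀ τ : ℝ, 0 ≤ τ → Integrable (f τ) μ :=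
    fun μ _ h τ hτ => exp_integrable μ h τ hτ
  have hf0 : ∀ τ E, 0 ≤ f τ E := fun τ E => (Real.exp_pos _).le
  have hTt : 0 ≤ T - t := by linarith
  have hTt₂ : 0 ≤ T - t₂ := by linarith
  -- split of `∫ f τ ∂ν` along `ν = ν₁ + ν₂`
  have hsplitI : ∀ τ : ℝ, 0 ≤ τ → ∫ E, f τ E ∂ν = ∫ E, f τ E ∂ν₁ + ∫ E, f τ E ∂ν₂ := by
    intro τ hτ
    conv_lhs => rw [← hsplit]
    exact integral_add_measure (hfI ν₁ hsupp₁ τ hτ) (hfI ν₂ hsupp₂ τ hτ)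
  -- (1) window part on ν₁: the anchored core
  have hcore := anchored_core ν₁ hsupp₁ A x₀ hA hx₀ (majorant_restrict ν A x₀ hA hx₀ hx₀1 hmaj) ht0 htt h1 h4
  have h1' : ∫ E, f t₂ E ∂ν₁ ≤ ∫ E, f t₂ E ∂ν := by
    rw [hsplitI t₂ ht₂0.le]
    have : 0 ≤ ∫ E, f t₂ E ∂ν₂ := integral_nonneg fun E => hf0 t₂ E
    linarith
  set F₂ := ∫ E, f t₂ E ∂ν with hF₂
  have hF₂0 : 0 ≤ F₂ := integral_nonneg fun E => hf0 t₂ E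
  have hC₁ : 0 ≤ Real.exp 4 * (1 + 2 * A * 16 ^ 8) := by positivity
  have step1 : t ^ 8 * ∫ E, f t E ∂ν₁ ≤ Real.exp 4 * (1 + 2 * A * 16 ^ 8) * t₂ ^ 8 * F₂ :=
    hcore.trans (mul_le_mul_of_nonneg_left h1' (by positivity))
  -- (2) UV decreasing part on ν₂
  have hae₂ : ∀ᵐ E ∂ν₂, (1 : ℝ) ≤ E := by
    rw [hν₂]; exact (ae_restrict_mem measurableSet_Ici)
  have h2a : ∫ E, f t E ∂ν₂ ≤ ∫ E, Real.exp (-(t - 2)) * Real.exp (-(2 * E)) ∂ν₂ := by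
    have hI2 : Integrable (fun E => Real.exp (-(2 * E))) ν₂ := by
      have : (fun E : ℝ => Real.exp (-(2 * E))) = f 2 := by funext E; simp only [hf]; ring_nf
      rw [this]; exact hfI ν₂ hsupp₂ 2 (by norm_num)
    refine integral_mono_ae (hfI ν₂ hsupp₂ t ht0.le) (hI2.const_mul _) ?_
    filter_upwards [hae₂] with E hE
    simp only [hf]
    rw [← Real.exp_add]
    apply Real.exp_le_exp.mpr
    nlinarith
  have huv₂ : ∫ E, Real.exp (-(2 * E)) ∂ν₂ ≤ A * (ν (Iio 1)).toReal := by rw [hν₂]; exact huv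
  have h2b : ∫ E, Real.exp (-(t - 2)) * Real.exp (-(2 * E)) ∂ν₂ ≤ Real.exp (-(t - 2)) * (A * (ν (Iio 1)).toReal) := by
    rw [integral_const_mul]
    exact mul_le_mul_of_nonneg_left huv₂ (Real.exp_pos _).le
  have h2c := cum_one_le_anchored ν hsupp A x₀ hA hx₀ hx₀1 hmaj ht₂0.le h1 h4
  have h2d := pow_eight_exp_le t ht0.le
  have step2 : t ^ 8 * ∫ E, f t E ∂ν₂ ≤ A ^ 2 * 8 ^ 8 * Real.exp 6 * t₂ ^ 8 * F₂ := by
    have hA0 : 0 ≤ A := by linarith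
    have step : ∫ E, f t E ∂ν₂ ≤ Real.exp (-(t - 2)) * (A * (A * Real.exp 4 * t₂ ^ 8 * F₂)) :=
      (h2a.trans h2b).trans (mul_le_mul_of_nonneg_left (mul_le_mul_of_nonneg_left h2c hA0) (Real.exp_pos _).le)
    have he6 : Real.exp 2 * Real.exp 4 = Real.exp 6 := by rw [← Real.exp_add]; norm_num
    calc t ^ 8 * ∫ E, f t E ∂ν₂ ≤ t ^ 8 * (Real.exp (-(t - 2)) * (A * (A * Real.exp 4 * t₂ ^ 8 * F₂))) :=
          mul_le_mul_of_nonneg_left step (by positivity)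
      _ = (t ^ 8 * Real.exp (-(t - 2))) * (A ^ 2 * Real.exp 4 * t₂ ^ 8 * F₂) := by ring
      _ ≤ (8 ^ 8 * Real.exp 2) * (A ^ 2 * Real.exp 4 * t₂ ^ 8 * F₂) :=
          mul_le_mul_of_nonneg_right h2d (by positivity)
      _ = A ^ 2 * 8 ^ 8 * (Real.exp 2 * Real.exp 4) * t₂ ^ 8 * F₂ := by ring
      _ = A ^ 2 * 8 ^ 8 * Real.exp 6 * t₂ ^ 8 * F₂ := by rw [he6]
  -- (3) reflected part on the whole ν: monotone in t
  have hae : ∀ᵐ E ∂ν, (0 : ℝ) ≤ E := by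
    filter_upwards [measure_eq_zero_iff_ae_notMem.1 hsupp] with E hE
    exact le_of_lt (not_le.1 hE)
  set G := ∫ E, f (T - t₂) E ∂ν with hG
  have hG0 : 0 ≤ G := integral_nonneg fun E => hf0 _ E
  have h3a : ∫ E, f (T - t) E ∂ν ≤ G := by
    refine integral_mono_ae (hfI ν hsupp _ hTt) (hfI ν hsupp _ hTt₂) ?_
    filter_upwards [hae] with E hE
    simp only [hf]
    apply Real.exp_le_exp.mpr
    nlinarith
  have hpow : t ^ 8 ≤ t₂ ^ 8 := pow_le_pow_left₀ ht0.le htt 8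
  have step3 : t ^ 8 * ∫ E, f (T - t) E ∂ν ≤ t₂ ^ 8 * G :=
    (mul_le_mul_of_nonneg_left h3a (by positivity)).trans (mul_le_mul_of_nonneg_right hpow hG0)
  have step0 : t ^ 8 * κ₀ ≤ t₂ ^ 8 * κ₀ := mul_le_mul_of_nonneg_right hpow hκ₀
  -- bookkeeping
  have hLt : ∫ E, (f t E + f (T - t) E) ∂ν = (∫ E, f t E ∂ν₁ + ∫ E, f t E ∂ν₂) + ∫ E, f (T - t) E ∂ν := by
    rw [integral_add (hfI ν hsupp t ht0.le) (hfI ν hsupp _ hTt), hsplitI t ht0.le]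
  have hRt : ∫ E, (f t₂ E + f (T - t₂) E) ∂ν = F₂ + G := by
    rw [integral_add (hfI ν hsupp t₂ ht₂0.le) (hfI ν hsupp _ hTt₂)]
  show t ^ 8 * (κ₀ + ∫ E, (f t E + f (T - t) E) ∂ν) ≤
      (Real.exp 4 * (1 + 2 * A * 16 ^ 8) + A ^ 2 * 8 ^ 8 * Real.exp 6 + 1) * t₂ ^ 8 * (κ₀ + ∫ E, (f t₂ E + f (T - t₂) E) ∂ν)
  rw [hLt, hRt]
  have ht₂8 : 0 ≤ t₂ ^ 8 := by positivity
  have hK₂ : 0 ≤ A ^ 2 * 8 ^ 8 * Real.exp 6 := by positivity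
  have lhs : t ^ 8 * (κ₀ + ((∫ E, f t E ∂ν₁ + ∫ E, f t E ∂ν₂) + ∫ E, f (T - t) E ∂ν)) =
      t ^ 8 * κ₀ + t ^ 8 * ∫ E, f t E ∂ν₁ + t ^ 8 * ∫ E, f t E ∂ν₂ + t ^ 8 * ∫ E, f (T - t) E ∂ν := by ring
  rw [lhs]
  -- each piece is bounded by a multiple of `t₂⁸ (κ₀ + F₂ + G)`
  have hS0 : 0 ≤ κ₀ + (F₂ + G) := by positivity
  have b0 : t₂ ^ 8 * κ₀ ≤ 1 * t₂ ^ 8 * (κ₀ + (F₂ + G)) := by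
    rw [one_mul]; exact mul_le_mul_of_nonneg_left (by linarith) ht₂8
  have b1 : Real.exp 4 * (1 + 2 * A * 16 ^ 8) * t₂ ^ 8 * F₂ ≤
      Real.exp 4 * (1 + 2 * A * 16 ^ 8) * t₂ ^ 8 * (κ₀ + (F₂ + G)) :=
    mul_le_mul_of_nonneg_left (by linarith) (by positivity)
  have b2 : A ^ 2 * 8 ^ 8 * Real.exp 6 * t₂ ^ 8 * F₂ ≤ A ^ 2 * 8 ^ 8 * Real.exp 6 * t₂ ^ 8 * (κ₀ + (F₂ + G)) :=
    mul_le_mul_of_nonneg_left (by linarith) (by positivity)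
  have b3 : t₂ ^ 8 * G ≤ t₂ ^ 8 * (κ₀ + (F₂ + G)) - t₂ ^ 8 * κ₀ := by
    have : t₂ ^ 8 * (κ₀ + (F₂ + G)) - t₂ ^ 8 * κ₀ = t₂ ^ 8 * (F₂ + G) := by ring
    rw [this]; exact mul_le_mul_of_nonneg_left (by linarith) ht₂8
  have rhs : (Real.exp 4 * (1 + 2 * A * 16 ^ 8) + A ^ 2 * 8 ^ 8 * Real.exp 6 + 1) * t₂ ^ 8 * (κ₀ + (F₂ + G)) =
      Real.exp 4 * (1 + 2 * A * 16 ^ 8) * t₂ ^ 8 * (κ₀ + (F₂ + G)) +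
        A ^ 2 * 8 ^ 8 * Real.exp 6 * t₂ ^ 8 * (κ₀ + (F₂ + G)) + 1 * t₂ ^ 8 * (κ₀ + (F₂ + G)) := by ring
  rw [rhs]
  linarith [step0, step1, step2, step3, b1, b2, b3]

end Summit.QuantumFields.YangMills.Cruxes.ScaleMonotonicity.SpectralA
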